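import Summits.QuantumFields.YangMills.Theorems.BalabanUVNodesN15CovariantTwoGridPairingLetters
import Summits.QuantumFields.YangMills.Theorems.BalabanUVNodesN15CovariantTwoGridPullbackSizes
import HarnessLib

/-!
# N15 = NE2, road (c) — PROGRAMME (PC) «[B9] Sect. C FOR THE LANDAU LETTER WITH PER-CUBE GAUGES (3.35) AS PRINTED», (PC-E) (C6-e1): THE CELL OSCILLATION LETTER `Ω` OF n15-c∕343∕344
# FROM A LOCALIZED STEP LETTER — King's block staircase walked backwards: `‖f(x′) − f(σπx′)‖ ≤ (d+1)(L^m−1)·b`, `‖f(σy) − f(σy ± te′)‖ ≤ t·b`, with the step letter `b` needed only on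
# the two King cells involved (dag-n15-c g32, n15-c∕345)

Cell `pub-ymgap`, seat `pub-ymgap-dag-n15-c` (generation g32; R134 (a) seat, strategy s1 «first missing estimate»; HUMAN RULING D-0062; chair R424 venue).
`bears_on: R4∕N15 · K3⁸ SpineGivenEndpointR13SepCoPHV (stmt-QuantumFields-27366)`; filed `--kind proof --supports stmt-QuantumFields-27366 --as helper` — COUNT-NEUTRAL.
THEOREMS only ([folklore] lattice bookkeeping on King's torus pair), 0 `def`, 0 `sorry`.  Imports BY NAME n15-c∕341 `…CovariantTwoGridPairingLetters` (`norm_chain_sub_le`, `kingSec_sub_unitVec`;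
through it n15-c g21 `kingPr_add_smul_of_dvd`), dag-n15-a `…CovariantTwoGridPullbackSizes` (`kingPr_kingLegStart_add_smul`; through it `kingLegStart_zero`∕`_succ`∕`_of_le`, `kingOff_lt`,
`kingBase_eq_kingSec_kingPr`, `kingPr_kingSec`, `kingSec_val`).  Nothing in the tree is modified, no landed name re-declared.

WHY.  n15-c∕343 `sc_hfitA_of_pairing` and n15-c∕344 `sc_hfitC_of_pairing` display an OSCILLATION letter `Ω`: `‖V′_μ(x′) − V′_μ(σπx′ + te′_μ)‖ ≤ Ω` and `‖V′_μ(x′ − e′_μ) − V′_μ(σ(πx′ − e_μ) + te′_μ)‖ ≤ Ω`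
(`t < L^r`).  Both follow from the second (3.35) letter — a STEP letter `‖V′_μ(z + e′_κ) − V′_μ(z)‖ ≤ b` (dag-n15-w2 `uN_opLetters_of_gauge335`, all `κ`) — by walking: from `x′` back to
the base point `σπx′` of its King cell along the staircase legs (`≤ (d+1)(L^m − 1)` steps, every visited point in the cell of `x′`: dag-n15-a `kingPr_kingLegStart_add_smul`), then along
the line (`≤ L^m` steps in the cell of `πx′` or of `πx′ − e_μ`).  dag-n15-a's `fibre_conn_kingPrV` is the global-letter edition; HERE the step letter is assumed on a SET `Q` only and
the cells are put in `Q` by hypothesis — the per-cube form the (PC) chain needs.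

RESULTS ([folklore]; `σ = kingSec`, `π = kingPr`, `e′_i = unitVec (fine (L^mL^k) M) i`).  ★ `norm_sub_kingLegStart_le` (leg induction), ★★ `norm_sub_kingSec_kingPr_le` (`‖f x′ − f(σπx′)‖ ≤
(d+1)(L^m−1)·b`), `norm_kingSec_line_le` (`‖f(σy) − f(σy + te′)‖ ≤ t·b`, `t ≤ L^m`), `norm_kingSec_line_down_le` (`‖f(σy) − f(σy − te′)‖ ≤ t·b`, steps read backwards in the cell of
`y − e_μ`), ★★ `norm_cellOsc_le` ∕ ★★ `norm_cellOsc_back_le` (343∕344's two `Ω`-hypotheses with `Ω = ((d+1)(L^m−1) + L^m + 1)·b`).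

HONEST FRAMING ∕ LIMITS.  Lattice bookkeeping only; nothing of [B7]∕[B9] asserted ((125) p.36, (3.35) p.396 = SHAPES; King's pairing p.664).  NE2⁺ NOT PRINTED, NOT proved; N15 of record
untouched (DISCHARGED AS CONSUMED, p687738); K3⁸ OPEN; counts of record UNMOVED (typed 28∕28 · discharged 8∕27); one finite 𝕋⁴ at fixed ε per index — NOT infinite volume, NOT OS on ℝ⁴,
NOT a mass gap, NOT Clay.  Restate-immune (no Theses import).
-/

set_option autoImplicit false

noncomputable section

open scoped BigOperators
open Finset

namespace Summit.QuantumFields.YangMills.BalabanUVNodes.N15.CovAvg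

open Literature.MathematicalPhysics.QuantumFieldTheory.Balaban1983to89
open Literature.MathematicalPhysics.QuantumFieldTheory.Balaban1983to89.B5Prop11Plancherel (Tor fine unitVec)
open Summit.QuantumFields.YangMills.BalabanUVNodes.N15.VectorPiece (kingPr)

variable {d : ℕ} (M : Fin (d + 1) → ℕ) [∀ μ, NeZero (M μ)] (L k m : ℕ) [NeZero L] {E : Type} [SeminormedAddCommGroup E]

/-- ★ **LEG INDUCTION**: with a step letter `b` in every direction at every point of the King cell of `x′`, the value at the start of leg `i` is within `i·(L^m − 1)·b` of the value at the
base point. [cite: King1986, p.664 (pairing convention); Balaban1985Averaging, (125) p.36 (the staircase: shape)] -/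
theorem norm_sub_kingLegStart_le (f : Tor (fine (L ^ m * L ^ k) M) → E) {b : ℝ} (hb : 0 ≤ b) (x' : Tor (fine (L ^ m * L ^ k) M))
    (hstep : ∀ (i : Fin (d + 1)) (z : Tor (fine (L ^ m * L ^ k) M)), kingPr L k m M z = kingPr L k m M x' → ‖f (z + unitVec (fine (L ^ m * L ^ k) M) i) - f z‖ ≤ b) :
    ∀ i : ℕ, i ≤ d + 1 → ‖f (kingLegStart M (L ^ m * L ^ k) (L ^ m) x' i) - f (kingLegStart M (L ^ m * L ^ k) (L ^ m) x' 0)‖ ≤ i * (((L ^ m - 1 : ℕ) : ℝ) * b) := by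
  have hLm : 0 < L ^ m := pow_pos (Nat.pos_of_ne_zero (NeZero.ne L)) m
  intro i
  induction i with
  | zero => intro _; simp
  | succ i ih =>
      intro hi
      have hi' : i < d + 1 := Nat.lt_of_succ_le hi
      have hprev := ih hi'.le
      -- the leg `i`: `kingOff x′ i < L^m` steps in direction `i`, all inside the cell of `x′`
      set c : ℕ := kingOff M (L ^ m * L ^ k) (L ^ m) x' ⟨i, hi'⟩ with hc
      have hcL : c ≤ L ^ m - 1 := Nat.le_sub_one_of_lt (kingOff_lt M (L ^ m * L ^ k) (L ^ m) hLm x' ⟨i, hi'⟩)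
      have hleg : ‖f (kingLegStart M (L ^ m * L ^ k) (L ^ m) x' i) - f (kingLegStart M (L ^ m * L ^ k) (L ^ m) x' (i + 1))‖ ≤ c * b := by
        rw [kingLegStart_succ M (L ^ m * L ^ k) (L ^ m) x' i hi']
        have h := norm_chain_sub_le (fun s : ℕ => f (kingLegStart M (L ^ m * L ^ k) (L ^ m) x' i + s • unitVec (fine (L ^ m * L ^ k) M) ⟨i, hi'⟩)) (N := c) (κ := b)
          (fun s hs => by
            rw [norm_sub_rev, succ_nsmul, ← add_assoc]
            exact hstep ⟨i, hi'⟩ _ (kingPr_kingLegStart_add_smul M L k m x' ⟨i, hi'⟩ hs))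
        simpa only [zero_smul, add_zero] using h
      calc ‖f (kingLegStart M (L ^ m * L ^ k) (L ^ m) x' (i + 1)) - f (kingLegStart M (L ^ m * L ^ k) (L ^ m) x' 0)‖
          ≤ ‖f (kingLegStart M (L ^ m * L ^ k) (L ^ m) x' (i + 1)) - f (kingLegStart M (L ^ m * L ^ k) (L ^ m) x' i)‖ +
              ‖f (kingLegStart M (L ^ m * L ^ k) (L ^ m) x' i) - f (kingLegStart M (L ^ m * L ^ k) (L ^ m) x' 0)‖ := norm_sub_le_norm_sub_add_norm_sub _ _ _
        _ ≤ c * b + i * (((L ^ m - 1 : ℕ) : ℝ) * b) := add_le_add (by rw [norm_sub_rev]; exact hleg) hprev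
        _ ≤ ((L ^ m - 1 : ℕ) : ℝ) * b + i * (((L ^ m - 1 : ℕ) : ℝ) * b) := add_le_add_left (mul_le_mul_of_nonneg_right (show (c : ℝ) ≤ ((L ^ m - 1 : ℕ) : ℝ) by exact_mod_cast hcL) hb) _
        _ = ((i + 1 : ℕ) : ℝ) * (((L ^ m - 1 : ℕ) : ℝ) * b) := by push_cast; ring

/-- ★★ **FROM A FINE SITE TO THE BASE POINT OF ITS KING CELL**: `‖f(x′) − f(σ(πx′))‖ ≤ (d+1)(L^m − 1)·b`, the step letter `b` assumed on the cell of `x′` only.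
[cite: King1986, p.664 (pairing convention); Balaban1985Averaging, (125)–(126) p.36 (shape)] -/
theorem norm_sub_kingSec_kingPr_le (f : Tor (fine (L ^ m * L ^ k) M) → E) {b : ℝ} (hb : 0 ≤ b) (x' : Tor (fine (L ^ m * L ^ k) M))
    (hstep : ∀ (i : Fin (d + 1)) (z : Tor (fine (L ^ m * L ^ k) M)), kingPr L k m M z = kingPr L k m M x' → ‖f (z + unitVec (fine (L ^ m * L ^ k) M) i) - f z‖ ≤ b) :
    ‖f x' - f (kingSec M L k m (kingPr L k m M x'))‖ ≤ ((d + 1 : ℕ) : ℝ) * (((L ^ m - 1 : ℕ) : ℝ) * b) := by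
  have h := norm_sub_kingLegStart_le M L k m f hb x' hstep (d + 1) le_rfl
  rwa [kingLegStart_of_le M (L ^ m * L ^ k) (L ^ m) x' le_rfl, kingLegStart_zero, kingBase_eq_kingSec_kingPr] at h

/-- THE LINE UPWARDS: `‖f(σy) − f(σy + te′_μ)‖ ≤ t·b` for `t ≤ L^m`, the step letter assumed on the cell of `y`. [cite: King1986, p.664 (pairing convention)] -/
theorem norm_kingSec_line_le (f : Tor (fine (L ^ m * L ^ k) M) → E) {b : ℝ} (μ : Fin (d + 1)) (y : Tor (fine (L ^ k) M)) {t : ℕ} (ht : t ≤ L ^ m)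
    (hstep : ∀ z : Tor (fine (L ^ m * L ^ k) M), kingPr L k m M z = y → ‖f (z + unitVec (fine (L ^ m * L ^ k) M) μ) - f z‖ ≤ b) :
    ‖f (kingSec M L k m y) - f (kingSec M L k m y + t • unitVec (fine (L ^ m * L ^ k) M) μ)‖ ≤ t * b := by
  have hLm : 0 < L ^ m := pow_pos (Nat.pos_of_ne_zero (NeZero.ne L)) m
  have hdvd : L ^ m ∣ (kingSec M L k m y μ).val := by rw [kingSec_val]; exact Dvd.intro _ rfl
  have h := norm_chain_sub_le (fun s : ℕ => f (kingSec M L k m y + s • unitVec (fine (L ^ m * L ^ k) M) μ)) (N := t) (κ := b) (fun s hs => by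
    rw [norm_sub_rev, succ_nsmul, ← add_assoc]
    refine hstep _ ?_
    rw [kingPr_add_smul_of_dvd M L k m _ μ hdvd s, kingPr_kingSec, Nat.div_eq_of_lt (lt_of_lt_of_le hs ht), zero_smul, add_zero])
  simpa only [zero_smul, add_zero] using h

/-- THE LINE DOWNWARDS: `‖f(σy) − f(σy − te′_μ)‖ ≤ t·b` for `t ≤ L^m`, the step letter read at the points `σy − se′_μ` (`1 ≤ s ≤ t`), which lie in the cell of `y − e_μ`.
[cite: King1986, p.664 (pairing convention)] -/
theorem norm_kingSec_line_down_le (f : Tor (fine (L ^ m * L ^ k) M) → E) {b : ℝ} (μ : Fin (d + 1)) (y : Tor (fine (L ^ k) M)) {t : ℕ} (ht : t ≤ L ^ m)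
    (hstep : ∀ z : Tor (fine (L ^ m * L ^ k) M), kingPr L k m M z = y - unitVec (fine (L ^ k) M) μ → ‖f (z + unitVec (fine (L ^ m * L ^ k) M) μ) - f z‖ ≤ b) :
    ‖f (kingSec M L k m y) - f (kingSec M L k m y - t • unitVec (fine (L ^ m * L ^ k) M) μ)‖ ≤ t * b := by
  have hLm : 0 < L ^ m := pow_pos (Nat.pos_of_ne_zero (NeZero.ne L)) m
  have hdvd : L ^ m ∣ (kingSec M L k m (y - unitVec (fine (L ^ k) M) μ) μ).val := by rw [kingSec_val]; exact Dvd.intro _ rfl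
  -- the point `σy − (s+1)e′ = σ(y − e) + (L^m − (s+1))e′` lies in the cell of `y − e_μ`
  have hcell : ∀ s < t, kingPr L k m M (kingSec M L k m y - (s + 1) • unitVec (fine (L ^ m * L ^ k) M) μ) = y - unitVec (fine (L ^ k) M) μ := fun s hs => by
    have e1 : kingSec M L k m y - (s + 1) • unitVec (fine (L ^ m * L ^ k) M) μ = kingSec M L k m (y - unitVec (fine (L ^ k) M) μ) + (L ^ m - (s + 1)) • unitVec (fine (L ^ m * L ^ k) M) μ := by
      rw [kingSec_sub_unitVec, sub_eq_iff_eq_add, add_assoc, ← add_smul, Nat.sub_add_cancel (by omega), sub_add_cancel]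
    rw [e1, kingPr_add_smul_of_dvd M L k m _ μ hdvd, kingPr_kingSec, Nat.div_eq_of_lt (by omega), zero_smul, add_zero]
  have h := norm_chain_sub_le (fun s : ℕ => f (kingSec M L k m y - s • unitVec (fine (L ^ m * L ^ k) M) μ)) (N := t) (κ := b) (fun s hs => by
    have e2 : kingSec M L k m y - s • unitVec (fine (L ^ m * L ^ k) M) μ = (kingSec M L k m y - (s + 1) • unitVec (fine (L ^ m * L ^ k) M) μ) + unitVec (fine (L ^ m * L ^ k) M) μ := by
      rw [succ_nsmul]; abel
    rw [e2]; exact hstep _ (hcell s hs))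
  simpa only [zero_smul, sub_zero] using h

/-- ★★ **343∕344's FIRST OSCILLATION LETTER**: `‖f(x′) − f(σ(πx′) + te′_μ)‖ ≤ ((d+1)(L^m−1) + L^m)·b` for `t ≤ L^m`, the step letter `b` (all directions) assumed on the King cell of `x′`.
[cite: Balaban1985BackgroundPropagators, (3.35) p.396 (the second letter: shape); King1986, p.664 (pairing)] -/
theorem norm_cellOsc_le (f : Tor (fine (L ^ m * L ^ k) M) → E) {b : ℝ} (hb : 0 ≤ b) (μ : Fin (d + 1)) (x' : Tor (fine (L ^ m * L ^ k) M)) {t : ℕ} (ht : t ≤ L ^ m)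
    (hstep : ∀ (i : Fin (d + 1)) (z : Tor (fine (L ^ m * L ^ k) M)), kingPr L k m M z = kingPr L k m M x' → ‖f (z + unitVec (fine (L ^ m * L ^ k) M) i) - f z‖ ≤ b) :
    ‖f x' - f (kingSec M L k m (kingPr L k m M x') + t • unitVec (fine (L ^ m * L ^ k) M) μ)‖ ≤ (((d + 1 : ℕ) : ℝ) * ((L ^ m - 1 : ℕ) : ℝ) + (L ^ m : ℕ)) * b := by
  have h1 := norm_sub_kingSec_kingPr_le M L k m f hb x' hstep
  have h2 := norm_kingSec_line_le M L k m f μ (kingPr L k m M x') ht (fun z hz => hstep μ z hz)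
  have ht' : (t : ℝ) * b ≤ (L ^ m : ℕ) * b := mul_le_mul_of_nonneg_right (by exact_mod_cast ht) hb
  calc _ ≤ ‖f x' - f (kingSec M L k m (kingPr L k m M x'))‖ + ‖f (kingSec M L k m (kingPr L k m M x')) - f (kingSec M L k m (kingPr L k m M x') + t • unitVec (fine (L ^ m * L ^ k) M) μ)‖ :=
        norm_sub_le_norm_sub_add_norm_sub _ _ _
    _ ≤ ((d + 1 : ℕ) : ℝ) * (((L ^ m - 1 : ℕ) : ℝ) * b) + t * b := add_le_add h1 h2
    _ ≤ _ := by nlinarith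

/-- ★★ **343∕344's SECOND OSCILLATION LETTER**: `‖f(x′ − e′_μ) − f(σ(πx′ − e_μ) + te′_μ)‖ ≤ ((d+1)(L^m−1) + L^m + 1)·b` for `t ≤ L^m` — one backward step at `x′` (the letter read at `x′ − e′_μ`,
a point of the cell of `πx′` or of `πx′ − e_μ`), the staircase of the cell of `x′`, then the line downwards in the cell of `πx′ − e_μ`.
[cite: Balaban1985BackgroundPropagators, (3.35) p.396 (shape); King1986, p.664 (pairing)] -/
theorem norm_cellOsc_back_le (f : Tor (fine (L ^ m * L ^ k) M) → E) {b : ℝ} (hb : 0 ≤ b) (μ : Fin (d + 1)) (x' : Tor (fine (L ^ m * L ^ k) M)) {t : ℕ} (ht : t ≤ L ^ m)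
    (hstep : ∀ (i : Fin (d + 1)) (z : Tor (fine (L ^ m * L ^ k) M)), kingPr L k m M z = kingPr L k m M x' → ‖f (z + unitVec (fine (L ^ m * L ^ k) M) i) - f z‖ ≤ b)
    (hstep' : ∀ z : Tor (fine (L ^ m * L ^ k) M), kingPr L k m M z = kingPr L k m M x' - unitVec (fine (L ^ k) M) μ → ‖f (z + unitVec (fine (L ^ m * L ^ k) M) μ) - f z‖ ≤ b)
    (hback : ‖f x' - f (x' - unitVec (fine (L ^ m * L ^ k) M) μ)‖ ≤ b) :
    ‖f (x' - unitVec (fine (L ^ m * L ^ k) M) μ) - f (kingSec M L k m (kingPr L k m M x' - unitVec (fine (L ^ k) M) μ) + t • unitVec (fine (L ^ m * L ^ k) M) μ)‖ ≤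
      (((d + 1 : ℕ) : ℝ) * ((L ^ m - 1 : ℕ) : ℝ) + (L ^ m : ℕ) + 1) * b := by
  have h1 := norm_sub_kingSec_kingPr_le M L k m f hb x' hstep
  have e1 : kingSec M L k m (kingPr L k m M x' - unitVec (fine (L ^ k) M) μ) + t • unitVec (fine (L ^ m * L ^ k) M) μ =
      kingSec M L k m (kingPr L k m M x') - (L ^ m - t) • unitVec (fine (L ^ m * L ^ k) M) μ := by
    rw [kingSec_sub_unitVec, sub_nsmul _ ht]; abel
  have h3 := norm_kingSec_line_down_le M L k m f μ (kingPr L k m M x') (t := L ^ m - t) (Nat.sub_le _ _) hstep'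
  have ht' : ((L ^ m - t : ℕ) : ℝ) * b ≤ (L ^ m : ℕ) * b := mul_le_mul_of_nonneg_right (by exact_mod_cast Nat.sub_le _ _) hb
  rw [e1]
  calc _ ≤ ‖f (x' - unitVec (fine (L ^ m * L ^ k) M) μ) - f x'‖ + ‖f x' - f (kingSec M L k m (kingPr L k m M x') - (L ^ m - t) • unitVec (fine (L ^ m * L ^ k) M) μ)‖ :=
        norm_sub_le_norm_sub_add_norm_sub _ _ _
    _ ≤ ‖f (x' - unitVec (fine (L ^ m * L ^ k) M) μ) - f x'‖ + (‖f x' - f (kingSec M L k m (kingPr L k m M x'))‖ +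
          ‖f (kingSec M L k m (kingPr L k m M x')) - f (kingSec M L k m (kingPr L k m M x') - (L ^ m - t) • unitVec (fine (L ^ m * L ^ k) M) μ)‖) :=
        add_le_add_right (norm_sub_le_norm_sub_add_norm_sub _ _ _) _
    _ ≤ b + (((d + 1 : ℕ) : ℝ) * (((L ^ m - 1 : ℕ) : ℝ) * b) + ((L ^ m - t : ℕ) : ℝ) * b) := add_le_add (by rw [norm_sub_rev]; exact hback) (add_le_add h1 h3)
    _ ≤ _ := by nlinarith

end Summit.QuantumFields.YangMills.BalabanUVNodes.N15.CovAvg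

end
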